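import Summits.CriticalPhenomena.PercolationContinuityZ3.Theorems.Transplant.SkelNeg1ParamsKit
import Summits.CriticalPhenomena.PercolationContinuityZ3.Theorems.Transplant.SkelNeg1ParamsP
import Summits.CriticalPhenomena.PercolationContinuityZ3.Theorems.Transplant.PlanarSkeletonFrmQuasiDefs
import Summits.CriticalPhenomena.PercolationContinuityZ3.Theorems.Transplant.PlanarSkeletonFrmDefs
import Summits.CriticalPhenomena.PercolationContinuityZ3.Theorems.Transplant.SkelPhiStepIDataNS
import Summits.CriticalPhenomena.PercolationContinuityZ3.Theorems.Transplant.SkelNegParamsLattice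
import Summits.CriticalPhenomena.PercolationContinuityZ3.Theorems.Transplant.SkelPhiStepINegDefs
import Summits.CriticalPhenomena.PercolationContinuityZ3.Theorems.Transplant.SkelNeg1ParamsO
import Summits.CriticalPhenomena.PercolationContinuityZ3.Theorems.Transplant.SkelFrmFrom1ParamsPO
import HarnessLib
import Summits.CriticalPhenomena.PercolationContinuityZ3.Theorems.Transplant.SkelFrm1ParamsPO
/-!
# GEN-Q PORT (WAVE-Q table v0.8 section 2, row G005, U-level L1; captain R-6/R-7 2026-08-27: carrier token swap `PlanarSkeletonFrmFrom ↦ PlanarSkeletonFrmQuasi`)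
# of the tree module «Transplant/SkelFrmFrom1ParamsPO» (sha256 ab8c39c064a740b8…) onto the quasi-step carrier `PlanarSkeletonFrmQuasi` (p507026): «SkelFrmQuasi1ParamsPO»

ORIGINAL TITLE: N2 (frames-only node `SamePDropOfSkeletonFrm₁`, OPEN) params column over `PlanarSkeletonFrm` — (ζ″) ledger, shape (B′) of record ((R-14)):

builds on p205010 (kernel theorem, internal audit signed; external expert review pending) — nothing in this file uses p205010; NOTHING is claimed about any open node
((N3-b), the end state).  Lane `prim-bschramm`, seat `prim-bschramm-gen-1` (gen 4; binder-wave captain).  Helper file (`--supports stmt-CriticalPhenomena-4575 --as helper`).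
PORT RULES (U-wave r1–r4 re-used, GEN-Q hunk classes of p3-g29 #6136): declaration order, names and proof texts are those of «SkelFrmFrom1ParamsPO», byte-identical except
(i) the carrier token `PlanarSkeletonFrmFrom ↦ PlanarSkeletonFrmQuasi` in binders, `namespace`/`end` lines and qualified names (module names `SkelFrmFrom… ↦ SkelFrmQuasi…`
in imports of already-ported rows); (ii) `Φ.step ↦ Φ.qstep` with the called Steps lemma replaced by its `…Q`/`_q` twin and the cost `Φ.M` threaded (none in this file unless
listed below); (iii) `Φ.cyl_connected ↦ Φ.cyl_reach` readers (none unless listed); (iv) graph-ball radii / window floors ×`Φ.M` (none unless listed).  Carrier-free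
residents stay imported/exported from the original «SkelFrm1ParamsPO» exactly as in the FrmFrom port.  Docstrings and citations are the original's.

-/

noncomputable section

namespace Summit.CriticalPhenomena.PercolationContinuityZ3.Theorems.Transplant

namespace Skelφ.NegPrm

/-! ## §0 Admissibility of the scale list under Step I″'s threshold FUNCTION (ledger V0 = option 1: `n₁ : ℕ → ℕ`) -/

end Skelφ.NegPrm

namespace PlanarSkeletonFrmQuasi

namespace Neg

open Literature.Probability.Percolation Literature.Probability.LatticeModels SimpleGraph
open SkelConc (Consts)
open BoxProdZ2 (Kof)

section Handed

/-! ## §1 From the handed constants: the cell constant and the cells -/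

export PlanarSkeletonNeg.Neg (K)

export PlanarSkeletonNeg.Neg (Kq)

export PlanarSkeletonNeg.Neg (cells)

export PlanarSkeletonNeg.Neg (K_eq)

export PlanarSkeletonNeg.Neg (K₀_le_K)

export PlanarSkeletonNeg.Neg (Kof_le_K)

export PlanarSkeletonNeg.Neg (forty_le_K)

export PlanarSkeletonNeg.Neg (one_le_Kq)

export PlanarSkeletonNeg.Neg (forty_dvd_K)

export PlanarSkeletonNeg.Neg (cells_K)

export PlanarSkeletonNeg.Neg (cells_s)

export PlanarSkeletonNeg.Neg (cells_r)

export PlanarSkeletonNeg.Neg (cells_rmax)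

export PlanarSkeletonNeg.Neg (K₀_le_cells_K)

/-! ## §2 The instance constants `C′` and `c_max` -/

export PlanarSkeletonNeg.Neg (C')

export PlanarSkeletonNeg.Neg (cmax)

export PlanarSkeletonNeg.Neg (C'_eq)

export PlanarSkeletonNeg.Neg (cmax_eq)

end Handed

section Acc

/-! ## §3 The accuracies -/

/-- **The kit accuracy of N1** `δkit := Prm.δkit G Φ.degree_le κ 0` (budget `nmax 0 = 1000`). [this work] -/
def δkit (κ : Consts) {V : Type} [DecidableEq V] [Countable V] {G : SimpleGraph V} [G.LocallyFinite] (Φ : PlanarSkeletonFrmQuasi G) : ℝ := Skelφ.Prm.δkit G Φ.degree_le κ 0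

/-- **The Step-I″ accuracy of N1** `δI := Prm.δI G Φ.degree_le κ 0 = δkit²/16`. [this work] -/
def δI (κ : Consts) {V : Type} [DecidableEq V] [Countable V] {G : SimpleGraph V} [G.LocallyFinite] (Φ : PlanarSkeletonFrmQuasi G) : ℝ := Skelφ.Prm.δI G Φ.degree_le κ 0

/-- **The excess accuracy** `η := δkit/2`. [this work] -/
def η (κ : Consts) {V : Type} [DecidableEq V] [Countable V] {G : SimpleGraph V} [G.LocallyFinite] (Φ : PlanarSkeletonFrmQuasi G) : ℝ := Neg.δkit κ Φ / 2

/-- `0 < δkit`. [folklore] -/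
theorem δkit_pos (κ : Consts) {V : Type} [DecidableEq V] [Countable V] {G : SimpleGraph V} [G.LocallyFinite] (Φ : PlanarSkeletonFrmQuasi G) : 0 < Neg.δkit κ Φ := Skelφ.Prm.δkit_pos G Φ.degree_le κ 0

/-- `δkit ≤ 1`. [folklore] -/
theorem δkit_le_one (κ : Consts) {V : Type} [DecidableEq V] [Countable V] {G : SimpleGraph V} [G.LocallyFinite] (Φ : PlanarSkeletonFrmQuasi G) : Neg.δkit κ Φ ≤ 1 := Skelφ.Prm.δkit_le_one G Φ.degree_le κ 0

/-- `δkit ≤ κ.δ` (the corridor kits). [folklore] -/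
theorem δkit_le_δ (κ : Consts) {V : Type} [DecidableEq V] [Countable V] {G : SimpleGraph V} [G.LocallyFinite] (Φ : PlanarSkeletonFrmQuasi G) : Neg.δkit κ Φ ≤ κ.δ := Skelφ.Prm.δkit_le_δ G Φ.degree_le κ 0

/-- `δkit ≤ κ.δ₂` (the face kits). [folklore] -/
theorem δkit_le_δ₂ (κ : Consts) {V : Type} [DecidableEq V] [Countable V] {G : SimpleGraph V} [G.LocallyFinite] (Φ : PlanarSkeletonFrmQuasi G) : Neg.δkit κ Φ ≤ κ.δ₂ := Skelφ.Prm.δkit_le_δ₂ G Φ.degree_le κ 0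

/-- `δkit ≤ κ.δr n` for every root-run length `n ≤ 1000` (`N_R + 1 ≤ 481`). [folklore] -/
theorem δkit_le_δr (κ : Consts) {V : Type} [DecidableEq V] [Countable V] {G : SimpleGraph V} [G.LocallyFinite] (Φ : PlanarSkeletonFrmQuasi G) {n : ℕ} (hn : n ≤ 1000) : Neg.δkit κ Φ ≤ κ.δr n := Skelφ.NegPrm.δkit₀_le_δr G Φ.degree_le κ hn

-- GEN-Q (R-2, captain 2026-08-27): `PlanarSkeletonFrmFrom.Neg.δkit_le_δUP` is not in the used cone of the node top — not ported.

/-- `0 < δI`. [folklore] -/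
theorem δI_pos (κ : Consts) {V : Type} [DecidableEq V] [Countable V] {G : SimpleGraph V} [G.LocallyFinite] (Φ : PlanarSkeletonFrmQuasi G) : 0 < Neg.δI κ Φ := Skelφ.Prm.δI_pos G Φ.degree_le κ 0

-- GEN-Q (R-2, captain 2026-08-27): `PlanarSkeletonFrmFrom.Neg.δI_le_one` is not in the used cone of the node top — not ported.

/-- `δI = (δkit/4)²` and `δI ≤ δkit²`. [folklore] -/
theorem δI_eq (κ : Consts) {V : Type} [DecidableEq V] [Countable V] {G : SimpleGraph V} [G.LocallyFinite] (Φ : PlanarSkeletonFrmQuasi G) : Neg.δI κ Φ = (Neg.δkit κ Φ / 4) ^ 2 ∧ Neg.δI κ Φ ≤ Neg.δkit κ Φ ^ 2 :=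
  ⟨Skelφ.Prm.δI_eq G Φ.degree_le κ 0, Skelφ.Prm.δI_le_sq G Φ.degree_le κ 0⟩

-- GEN-Q (R-2, captain 2026-08-27): `PlanarSkeletonFrmFrom.Neg.δI_le_sq_of_le` is not in the used cone of the node top — not ported.

/-- `0 < η`, `η ≤ δkit/2`, `2η = δkit`. [folklore] -/
theorem η_pos (κ : Consts) {V : Type} [DecidableEq V] [Countable V] {G : SimpleGraph V} [G.LocallyFinite] (Φ : PlanarSkeletonFrmQuasi G) : 0 < Neg.η κ Φ ∧ Neg.η κ Φ ≤ Neg.δkit κ Φ / 2 ∧ 2 * Neg.η κ Φ = Neg.δkit κ Φ := by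
  refine ⟨?_, le_rfl, ?_⟩
  · unfold η; exact half_pos (Neg.δkit_pos κ Φ)
  · unfold η; ring

-- GEN-Q (R-2, captain 2026-08-27): `PlanarSkeletonFrmFrom.Neg.inputs_mono` is not in the used cone of the node top — not ported.

end Acc

end Neg

end PlanarSkeletonFrmQuasi

end Summit.CriticalPhenomena.PercolationContinuityZ3.Theorems.Transplant

end

/-!
# N2 (frames-only node `SamePDropOfSkeletonFrm₁`, OPEN) params column over `PlanarSkeletonFrm` — (ζ″) ledger, shape (B′) of record ((R-14)):
# MECHANICAL PORT of N1's `SkelNeg1ParamsO` — part 3a (O-level values, skeleton-level): THE SHORT SCALE, THE KIT, THE COUNTS AND THE LONG BOX of the {±1} node's choice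
# function as functions of the Step-I″ record `D : Skelφ.StepI.DataN V` (p272964) — … (N1 title abridged; see `SkelNeg1ParamsO`)
builds on p205010 (kernel theorem, internal audit signed; external expert review pending) — nothing in this file uses p205010; NOTHING is claimed about the
open node `SamePDropOfSkeletonFrm₁` (`SamePDropOfSkeletonNeg₁` is CLOSED in the tree and untouched by this file).
Status sentence (coordinator 2026-08-20T04:30Z): "θ(p_c) = 0 on ℤ^d, all d ≥ 2 — kernel-verified (Lean 4/Mathlib, standard axioms); internal adversarial
audit SIGNED 2026-08-20 04:29Z; external expert review pending."
Lane `prim-bschramm-*`, seat `prim-bschramm-stmt` (gen 19); helper file (`--supports stmt-CriticalPhenomena-4575 --as helper`); ledger HOME/prim-bschramm-stmt/FRM-PARAMS.md §9, (R-14).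
PORT RULES (HOME/prim-bschramm-stmt-g19/lean/port_frm.py, the tool of record per (R-14)): outer namespace `PlanarSkeletonNeg ↦ PlanarSkeletonFrm`, carrier binder
`(Φ : PlanarSkeletonFrmQuasi G)`, record binder `(D : Skelφ.StepI.DataNS V)` (the selectors travel IN the record, `SkelPhiStepIDataNS`); section variables INLINED into every
declaration header; inner namespaces (`Neg`/`NegB`/`KS`/…) and every short name KEPT so all cross-references resolve unchanged; declarations using no section variable are
NOT re-declared (N1's originals are referenced fully qualified). Mathematical content, proofs, docstrings and citations are N1's, verbatim, except where stated next.
SELECTORS IN THIS FILE ((R-14) condition of record — joint selection, `D.sN`'s first argument is the literal handed to `D.sM`): SHORT pair `Mu D := D.sM D.M₀`, `nS D := D.sN D.M₀ (NegPrm.nS (D.n₁ (Mu D)) (Mu D) 0 (ρz D))` (zone floor `D.M₀` in BOTH selectors); `short_pair_eq` by rfl; `M₀_le_Mu/k_le_Mu/n₁_le_nS/Mu_lt_nS/ρz_le_nS` gain one `le_sM/le_sN` step.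
N1 HEADER (kept for the reader):
helper file (`--supports stmt-CriticalPhenomena-4575 --as helper`); ledger HOME/prim-bschramm-stmt/NEG-PARAMS.md v0.6.
ORDER (N.3 for N1, O-level part, every value a SEPARATE small definition so the unpacking files state facts by name): Step I″ hands `D` (`Λ, k, R, M₀, n₁ : ℕ → ℕ`,
`hgt/len/spl : V → ℕ → ℕ → _`; `StepI.exists_stepI_neg`, p3) → zone scale **`Mu := D.M₀`** (`Sz = {Mu}`), zone radius **`ρz := D.R Mu`** (no offset in N1) → short width
**`nS := NegPrm.nS (D.n₁ Mu) Mu 0 ρz = max (n₁ Mu) (Mu + 2 + ρz)`** (`R′`-free, v0.5 (n4)′) → short data **`(hS, ℓS, vS) := (D.hgt, D.len, D.spl) t Mu nS`** at the TYPE `t` → kit square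
**`As := NegPrm.As nS hS ℓS = D.scale t Mu nS`** (`As_eq_scale`, rfl), clamp `Mk`, `T₀ := tanOff Mk Mk`, depth `Kd`, `cU`, `Rseed`, `rs` (SkelNeg1ParamsKit at `R := D.R`) → Step-III sizes `sB, B` →
counts at `p`: `kP, NP, Lcnt` (`kitK/kitN/kitL` at `Neg.δkit`, verbatim D″) → levels `Rlev := T₀ + Lcnt`, **`R′ := Rlev + 1`** → long box
**`ML := NegPrm.ML Mu C′ c_max (4·K) R′ |hS| ℓS nS`** (floors `2C′(|h_s|+ℓ_s+n_s)`, `960 − 1`, `4K(R′+2)`, `Mu`) → long threshold `n₁L := D.n₁ ML`.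
* §1 the values; §2 the facts by name: `M₀_le_Mu`, `n₁_le_nS`, `Mu_lt_nS`, `ρz_le_nS`, `As_eq_scale`, `Mu_succ_le_As`, `one_le_R'`, `T₀_eq`, the `M_L` floors
  (`Mu_le_ML`, `hop_floor_le_ML`, `slack_floor_le_ML : 960 ≤ ML + 1`, `coarse_floor_le_ML : 4K(R′+2) ≤ ML`, `kit_floors_ML : 4K·R′+2 ≤ ML ∧ 4K+2 ≤ ML ∧ 8K+2 ≤ ML`), and the SHORT-pair
  unpacking of `D.EqGeom` (`eqGeomS_facts : Mu < nS ∧ Mu < ℓS ∧ |vS| ≤ nS ∧ (Mu+1)(nS+|hS|) ≤ nS(ℓS+1)`).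
[cite: KozmaNitzan2024, §4 Theorem 6 (pp. 25–31): the order of constants; Lemma 10 Steps II–III (pp. 18–19)] [cite: MartineauTassion2017, §3.2 Lemma 3.5, §3.3 Lemma 3.7]
-/

noncomputable section

open scoped Classical

namespace Summit.CriticalPhenomena.PercolationContinuityZ3.Theorems.Transplant

namespace PlanarSkeletonFrmQuasi

namespace Neg

open Literature.Probability.Percolation Literature.Probability.LatticeModels SimpleGraph
open SkelConc (Consts)
open BoxProdZ2 (kitK kitN kitL)
open SkelI (tanOff)

section Data

/-! ## §1 The values read off `D` alone -/

export PlanarSkeletonFrmFrom.Neg (Mu)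

export PlanarSkeletonFrmFrom.Neg (ρz)

export PlanarSkeletonFrmFrom.Neg (nS)

export PlanarSkeletonFrmFrom.Neg (hS)

export PlanarSkeletonFrmFrom.Neg (ℓS)

export PlanarSkeletonFrmFrom.Neg (vS)

export PlanarSkeletonFrmFrom.Neg (As)

export PlanarSkeletonFrmFrom.Neg (Mk)

export PlanarSkeletonFrmFrom.Neg (T₀)

export PlanarSkeletonFrmFrom.Neg (Kd)

export PlanarSkeletonFrmFrom.Neg (short_pair_eq)

/-! ## §2a The facts read off `D` alone -/

export PlanarSkeletonFrmFrom.Neg (M₀_le_Mu)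

export PlanarSkeletonFrmFrom.Neg (k_le_Mu)

export PlanarSkeletonFrmFrom.Neg (n₁_le_nS)

export PlanarSkeletonFrmFrom.Neg (Mu_lt_nS)

export PlanarSkeletonFrmFrom.Neg (ρz_le_nS)

export PlanarSkeletonFrmFrom.Neg (As_eq_scale)

export PlanarSkeletonFrmFrom.Neg (As_eq)

export PlanarSkeletonFrmFrom.Neg (Mu_succ_le_As)

export PlanarSkeletonFrmFrom.Neg (Mk_eq_As)

export PlanarSkeletonFrmFrom.Neg (T₀_eq)

end Data

section OLevel

/-! ## §1b The values that read the skeleton (degree bound, frames) and the density -/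

/-- The face-count bound `cU := (Δ+1)^{R As}`. [this work] -/
def cU {V : Type} {G : SimpleGraph V} [G.LocallyFinite] (Φ : PlanarSkeletonFrmQuasi G) (t : V) (D : Skelφ.StepI.DataNS V) : ℕ := Skelφ.NegPrm.cU D.R (nS D) (hS t D) (ℓS t D) Φ.Δ

/-- The seed-slab radius `Rseed` (frame-uniform comparison radii). [this work] -/
def Rseed {V : Type} {G : SimpleGraph V} [G.LocallyFinite] (Φ : PlanarSkeletonFrmQuasi G) (t : V) (D : Skelφ.StepI.DataNS V) : ℕ := Skelφ.NegPrm.Rseed D.R (Mu D) (nS D) (hS t D) (ℓS t D) G Φ.φ Φ.types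

/-- The shell radius `rs` (also the near/far threshold of the kit). [this work] -/
def rs {V : Type} {G : SimpleGraph V} [G.LocallyFinite] (Φ : PlanarSkeletonFrmQuasi G) (t : V) (D : Skelφ.StepI.DataNS V) : ℕ := Skelφ.NegPrm.rs D.R (Mu D) (nS D) (hS t D) (ℓS t D) (ρz D) G Φ.φ Φ.types

/-- The Step-III seed-size bound `sB := 1 + Δ((Δ+1)^{Rseed} + T₀ + 2) + ((Δ+1)^{Rseed} + T₀ + 2)·cU`. [this work] -/
def sB {V : Type} {G : SimpleGraph V} [G.LocallyFinite] (Φ : PlanarSkeletonFrmQuasi G) (t : V) (D : Skelφ.StepI.DataNS V) : ℕ := 1 + Φ.Δ * ((Φ.Δ + 1) ^ Rseed Φ t D + (T₀ t D + 2)) + ((Φ.Δ + 1) ^ Rseed Φ t D + (T₀ t D + 2)) * cU Φ t D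

/-- The contact multiplier `B := (Δ+1)^{2 rs}`. [this work] -/
def B {V : Type} {G : SimpleGraph V} [G.LocallyFinite] (Φ : PlanarSkeletonFrmQuasi G) (t : V) (D : Skelφ.StepI.DataNS V) : ℕ := (Φ.Δ + 1) ^ (2 * rs Φ t D)

-- GEN-Q (R-2, captain 2026-08-27): `PlanarSkeletonFrmFrom.Neg.kP` is not in the used cone of the node top — not ported.

-- GEN-Q (R-2, captain 2026-08-27): `PlanarSkeletonFrmFrom.Neg.NP` is not in the used cone of the node top — not ported.

/-- The number of levels `Lcnt`. [this work] -/
def Lcnt (κ : Consts) {V : Type} [DecidableEq V] [Countable V] {G : SimpleGraph V} [G.LocallyFinite] (Φ : PlanarSkeletonFrmQuasi G) (t : V) (p : unitInterval) (D : Skelφ.StepI.DataNS V) : ℕ := kitL Φ.Δ (sB Φ t D) (B Φ t D) (Neg.δkit κ Φ) p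

/-- The window depth in levels `Rlev := T₀ + Lcnt`. [this work] -/
def Rlev (κ : Consts) {V : Type} [DecidableEq V] [Countable V] {G : SimpleGraph V} [G.LocallyFinite] (Φ : PlanarSkeletonFrmQuasi G) (t : V) (p : unitInterval) (D : Skelφ.StepI.DataNS V) : ℕ := T₀ t D + Lcnt κ Φ t p D

/-- **The band growth / kit-level displacement** `R′ := Rlev + 1` (φ-rows; in run units `R′ + 1`, p1's `SkelPhiParaRunDisp`). [this work] -/
def R' (κ : Consts) {V : Type} [DecidableEq V] [Countable V] {G : SimpleGraph V} [G.LocallyFinite] (Φ : PlanarSkeletonFrmQuasi G) (t : V) (p : unitInterval) (D : Skelφ.StepI.DataNS V) : ℕ := Rlev κ Φ t p D + 1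

/-- **The long BOX** `M_L := ML M_u C′ c_max (4K) R′ |h_s| ℓ_s n_s` (chosen AFTER the short data and the kit levels; every floor lives here). [this work] -/
def ML (κ : Consts) {V : Type} [DecidableEq V] [Countable V] {G : SimpleGraph V} [G.LocallyFinite] (Φ : PlanarSkeletonFrmQuasi G) (t : V) (p : unitInterval) (D : Skelφ.StepI.DataNS V) : ℕ := Skelφ.NegPrm.ML (Mu D) Neg.C' Neg.cmax (4 * Neg.K κ) (R' κ Φ t p D) (hS t D).natAbs (ℓS t D) (nS D)

-- GEN-Q (R-2, captain 2026-08-27): `PlanarSkeletonFrmFrom.Neg.n₁L` is not in the used cone of the node top — not ported.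

/-! ## §2b The facts that read the counts -/

-- GEN-Q (R-2, captain 2026-08-27): `PlanarSkeletonFrmFrom.Neg.nS_lt_R'` is not in the used cone of the node top — not ported.

/-- `1 ≤ R′` and `T₀ + 1 ≤ R′`. [folklore] -/
theorem one_le_R' (κ : Consts) {V : Type} [DecidableEq V] [Countable V] {G : SimpleGraph V} [G.LocallyFinite] (Φ : PlanarSkeletonFrmQuasi G) (t : V) (p : unitInterval) (D : Skelφ.StepI.DataNS V) : 1 ≤ R' κ Φ t p D ∧ T₀ t D + 1 ≤ R' κ Φ t p D := by unfold R' Rlev; omega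

/-- `M_u ≤ M_L`. [folklore] -/
theorem Mu_le_ML (κ : Consts) {V : Type} [DecidableEq V] [Countable V] {G : SimpleGraph V} [G.LocallyFinite] (Φ : PlanarSkeletonFrmQuasi G) (t : V) (p : unitInterval) (D : Skelφ.StepI.DataNS V) : Mu D ≤ ML κ Φ t p D := Skelφ.NegPrm.Mu_le_ML _ _ _ _ _ _ _ _

-- GEN-Q (R-2, captain 2026-08-27): `PlanarSkeletonFrmFrom.Neg.hop_floor_le_ML` is not in the used cone of the node top — not ported.

/-- The y′-layer slack floor `960 ≤ M_L + 1` (`320·c_max`, `c_max = 3`). [folklore] -/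
theorem slack_floor_le_ML (κ : Consts) {V : Type} [DecidableEq V] [Countable V] {G : SimpleGraph V} [G.LocallyFinite] (Φ : PlanarSkeletonFrmQuasi G) (t : V) (p : unitInterval) (D : Skelφ.StepI.DataNS V) : 960 ≤ ML κ Φ t p D + 1 := by
  have h := Skelφ.NegPrm.slack_floor_le_ML (Mu D) Neg.C' Neg.cmax (4 * Neg.K κ) (R' κ Φ t p D) (hS t D).natAbs (ℓS t D) (nS D)
  rw [Neg.cmax_eq.2] at h
  exact h

/-- The coarse floor `4K(R′+2) ≤ M_L` (and `4K ≤ M_L`). [folklore] -/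
theorem coarse_floor_le_ML (κ : Consts) {V : Type} [DecidableEq V] [Countable V] {G : SimpleGraph V} [G.LocallyFinite] (Φ : PlanarSkeletonFrmQuasi G) (t : V) (p : unitInterval) (D : Skelφ.StepI.DataNS V) : 4 * Neg.K κ * (R' κ Φ t p D + 2) ≤ ML κ Φ t p D ∧ 4 * Neg.K κ ≤ ML κ Φ t p D :=
  Skelφ.NegPrm.coarse_floor_le_ML _ _ _ _ _ _ _ _

-- GEN-Q (R-2, captain 2026-08-27): `PlanarSkeletonFrmFrom.Neg.kit_floors_ML` is not in the used cone of the node top — not ported.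

-- GEN-Q (R-2, captain 2026-08-27): `PlanarSkeletonFrmFrom.Neg.nS_le_ML` is not in the used cone of the node top — not ported.

-- GEN-Q (R-2, captain 2026-08-27): `PlanarSkeletonFrmFrom.Neg.eqGeomS_facts` is not in the used cone of the node top — not ported.

end OLevel

end Neg

end PlanarSkeletonFrmQuasi

end Summit.CriticalPhenomena.PercolationContinuityZ3.Theorems.Transplant

end
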